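import Mathlib

/-!
# ℓ² floor tools for real matrices: form floor ⇒ operator floor, inverses, perturbation `A + E`, Schur test, colour blocks `L ⊗ₖ 1`
# (for STUB-PLAN-S5U5-STEP1b §2 (4f)/(4g): LINE-19 S5 ⟨stmt-QuantumFields-24004⟩/⟨24335⟩, LINE-20 U5 ⟨24336⟩; part 1 of 3)

Width seat `ym-line-sfw-p2-w4` (prover-ym-line-sfw-p2-w4-g27-0).  Generic linear algebra over a finite index type, stated for the dot product
`v ⬝ᵥ w` and `Matrix.mulVec` (no norms, no `EuclideanSpace`), in the shape the bricks of planner `ym-idea-2`'s T-S5.4 use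
(`λ·(v ⬝ᵥ v) ≤ (M v) ⬝ᵥ (M v)` is the hypothesis of (4g) `GaussianTailBound`):
* `dotProduct_self_le_sq_mul_of_le_mul_dotProduct` — a quadratic-form floor `‖v‖² ≤ c·vᵀLv` gives the operator floor `‖v‖² ≤ c²‖Lv‖²`;
* `dotProduct_inv_mulVec_le_of_floor`, `isUnit_det_of_opFloor`, `inv_opBound_of_opFloor` — invertibility and the bounds `vᵀQ⁻¹v ≤ c‖v‖²`,
  `c‖B⁻¹w‖² ≤ ‖w‖²` from floors (Cauchy–Schwarz only; no positivity hypothesis);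
* **`opFloor_add`** — the ℓ² perturbation lemma `(l − m)²‖v‖² ≤ ‖(A + E)v‖²` from `l²‖v‖² ≤ ‖Av‖²`, `‖Ev‖² ≤ m²‖v‖²`, `0 ≤ m ≤ l`;
* **`mulVec_dotProduct_self_le_of_row_col`** — the Schur test `‖Ev‖² ≤ r²‖v‖²` from row- and column-ℓ¹ sums `≤ r` (so a row/column-ℓ¹
  control of the `ad(A)·d` perturbation `E(U)` of (4c) feeds the ℓ² world);
* `floor_blockDiagonal_const`, `opFloor_blockDiagonal_const`, `floor_kronecker_one`, `opFloor_kronecker_one` — both floors pass from `L` to the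
  colour-diagonal operator `blockDiagonal (fun _ : o => L) = L ⊗ₖ (1 : Matrix o o ℝ)` (Mathlib `kronecker_one`).
Parts 2 and 3 (`…DirichletSlabPoincare`, `…BoxLapPoincare`) supply the floor itself for the interior Dirichlet Laplacian / `BoxKernel.boxLap (2H) univ`.

Everything proved; no definitions; Mathlib only; standard axioms.  HONEST LABEL: an elementary, untabled glue lemma for step (1b) (Laplace asymptotics of the orbit average, STUB-PLAN-S5U5-STEP1b) of the XL stubs
S5 `stub_landauSecondOrder` / U5 `stub_landauThirdOrder` of critic-PASSed DRAFT lines on the R2ξ″ cruxes ⟨stmt-QuantumFields-24004⟩/⟨24335⟩/⟨24336⟩;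
T-S5.4 proper, S5, U5 and those items remain OPEN; no stub is closed by name, no crux, rung or summit is proved; the Yang–Mills mass gap is NOT
proved by this file.
-/

set_option autoImplicit false

open Finset Matrix
open scoped Kronecker

namespace Summit.QuantumFields.YangMills.Theorems.AllWindowsColdBoxBoxHighLine

namespace SpectralFloor

/-! ## Matrix tools: quadratic-form floors, operator floors, inverses, perturbation, Schur test, colour blocks -/

section Tools

variable {ι : Type*} [Fintype ι]

/-- **Quadratic-form floor ⇒ operator floor**: `‖v‖² ≤ c·(v·w)` with `c ≥ 0` gives `‖v‖² ≤ c²‖w‖²` (Cauchy–Schwarz).  With `w = Lv`: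
`λ_min(L) ≥ c⁻¹ ⇒ ‖Lv‖ ≥ c⁻¹‖v‖`. -/
theorem dotProduct_self_le_sq_mul_of_le_mul_dotProduct (v w : ι → ℝ) {c : ℝ} (hc : 0 ≤ c)
    (h : v ⬝ᵥ v ≤ c * (v ⬝ᵥ w)) : v ⬝ᵥ v ≤ c ^ 2 * (w ⬝ᵥ w) := by
  have hvv : 0 ≤ v ⬝ᵥ v := Finset.sum_nonneg fun i _ => mul_self_nonneg _
  have hww : 0 ≤ w ⬝ᵥ w := Finset.sum_nonneg fun i _ => mul_self_nonneg _
  have hcs : (v ⬝ᵥ w) ^ 2 ≤ (v ⬝ᵥ v) * (w ⬝ᵥ w) := by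
    simpa only [dotProduct, sq] using Finset.sum_mul_sq_le_sq_mul_sq Finset.univ v w
  by_cases h0 : v ⬝ᵥ v = 0
  · rw [h0]; exact mul_nonneg (sq_nonneg _) hww
  · have hpos : 0 < v ⬝ᵥ v := lt_of_le_of_ne hvv (Ne.symm h0)
    have hvw : 0 ≤ v ⬝ᵥ w := by
      by_contra hneg
      push Not at hneg
      nlinarith [mul_nonneg hc (le_of_lt (neg_pos.2 hneg))]
    have h1 : (v ⬝ᵥ v) * (v ⬝ᵥ v) ≤ (v ⬝ᵥ v) * (c ^ 2 * (w ⬝ᵥ w)) := by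
      calc (v ⬝ᵥ v) * (v ⬝ᵥ v) = (v ⬝ᵥ v) ^ 2 := (sq _).symm
        _ ≤ (c * (v ⬝ᵥ w)) ^ 2 := pow_le_pow_left₀ hvv h 2
        _ = c ^ 2 * (v ⬝ᵥ w) ^ 2 := by ring
        _ ≤ c ^ 2 * ((v ⬝ᵥ v) * (w ⬝ᵥ w)) := mul_le_mul_of_nonneg_left hcs (sq_nonneg _)
        _ = (v ⬝ᵥ v) * (c ^ 2 * (w ⬝ᵥ w)) := by ring
    exact le_of_mul_le_mul_left h1 hpos

variable [DecidableEq ι]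

/-- **Inverse form bound from a form floor** (no positivity hypothesis needed): if `Q` is invertible and `‖w‖² ≤ c·wᵀQw` for all `w`
(`c ≥ 0`), then `vᵀQ⁻¹v ≤ c‖v‖²` for all `v` (Cauchy–Schwarz with `w = Q⁻¹v`). -/
theorem dotProduct_inv_mulVec_le_of_floor (Q : Matrix ι ι ℝ) (hQ : IsUnit Q.det) {c : ℝ} (hc : 0 ≤ c)
    (h : ∀ w : ι → ℝ, w ⬝ᵥ w ≤ c * (w ⬝ᵥ (Q *ᵥ w))) (v : ι → ℝ) :
    v ⬝ᵥ (Q⁻¹ *ᵥ v) ≤ c * (v ⬝ᵥ v) := by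
  set w := Q⁻¹ *ᵥ v with hw
  have hQw : Q *ᵥ w = v := by rw [hw, Matrix.mulVec_mulVec, Matrix.mul_nonsing_inv Q hQ, Matrix.one_mulVec]
  have hww : w ⬝ᵥ w ≤ c * (w ⬝ᵥ v) := by have := h w; rwa [hQw] at this
  have hcs : (w ⬝ᵥ v) ^ 2 ≤ (w ⬝ᵥ w) * (v ⬝ᵥ v) := by
    simpa only [dotProduct, sq] using Finset.sum_mul_sq_le_sq_mul_sq Finset.univ w v
  have hvv : 0 ≤ v ⬝ᵥ v := Finset.sum_nonneg fun i _ => mul_self_nonneg _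
  rw [dotProduct_comm]
  by_cases hE : w ⬝ᵥ v ≤ 0
  · exact hE.trans (mul_nonneg hc hvv)
  · push Not at hE
    nlinarith [mul_nonneg hc hvv]

/-- **Invertibility from an operator floor**: `c‖v‖² ≤ ‖Bv‖²` for all `v` with `c > 0` makes `v ↦ Bv` injective, so `det B` is a unit. -/
theorem isUnit_det_of_opFloor (B : Matrix ι ι ℝ) {c : ℝ} (hc : 0 < c)
    (h : ∀ v : ι → ℝ, c * (v ⬝ᵥ v) ≤ (B *ᵥ v) ⬝ᵥ (B *ᵥ v)) : IsUnit B.det := by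
  rw [← Matrix.isUnit_iff_isUnit_det, ← Matrix.mulVec_injective_iff_isUnit]
  intro v w hvw
  have h0 : B *ᵥ (v - w) = 0 := by rw [Matrix.mulVec_sub, hvw, sub_self]
  have h1 := h (v - w)
  rw [h0, dotProduct_zero] at h1
  have h2 : (v - w) ⬝ᵥ (v - w) ≤ 0 := by
    by_contra hpos
    push Not at hpos
    exact absurd h1 (not_le.2 (mul_pos hc hpos))
  have h3 : (v - w) ⬝ᵥ (v - w) = 0 := le_antisymm h2 (Finset.sum_nonneg fun i _ => mul_self_nonneg _)
  exact sub_eq_zero.1 (dotProduct_self_eq_zero.1 h3)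

/-- **Inverse operator bound from an operator floor**: `c‖v‖² ≤ ‖Bv‖²` for all `v` and `det B` a unit give `c‖B⁻¹w‖² ≤ ‖w‖²` for all `w`
(`‖B⁻¹‖₂ ≤ c^{-1/2}`). -/
theorem inv_opBound_of_opFloor (B : Matrix ι ι ℝ) (hB : IsUnit B.det) {c : ℝ}
    (h : ∀ v : ι → ℝ, c * (v ⬝ᵥ v) ≤ (B *ᵥ v) ⬝ᵥ (B *ᵥ v)) (w : ι → ℝ) :
    c * ((B⁻¹ *ᵥ w) ⬝ᵥ (B⁻¹ *ᵥ w)) ≤ w ⬝ᵥ w := by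
  have := h (B⁻¹ *ᵥ w)
  rwa [Matrix.mulVec_mulVec, Matrix.mul_nonsing_inv B hB, Matrix.one_mulVec] at this

omit [DecidableEq ι] in
/-- **ℓ² perturbation lemma**: an operator floor `l²‖v‖² ≤ ‖Av‖²` and an operator bound `‖Ev‖² ≤ m²‖v‖²` with `0 ≤ m ≤ l` give the floor
`(l − m)²‖v‖² ≤ ‖(A + E)v‖²` (triangle inequality `‖(A+E)v‖ ≥ ‖Av‖ − ‖Ev‖`). -/
theorem opFloor_add (A E : Matrix ι ι ℝ) {l m : ℝ} (hm : 0 ≤ m) (hlm : m ≤ l)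
    (hA : ∀ v : ι → ℝ, l ^ 2 * (v ⬝ᵥ v) ≤ (A *ᵥ v) ⬝ᵥ (A *ᵥ v))
    (hE : ∀ v : ι → ℝ, (E *ᵥ v) ⬝ᵥ (E *ᵥ v) ≤ m ^ 2 * (v ⬝ᵥ v)) (v : ι → ℝ) :
    (l - m) ^ 2 * (v ⬝ᵥ v) ≤ ((A + E) *ᵥ v) ⬝ᵥ ((A + E) *ᵥ v) := by
  have hl : 0 ≤ l := hm.trans hlm
  set a := Real.sqrt ((A *ᵥ v) ⬝ᵥ (A *ᵥ v)) with ha_def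
  set b := Real.sqrt ((E *ᵥ v) ⬝ᵥ (E *ᵥ v)) with hb_def
  set n := Real.sqrt (v ⬝ᵥ v) with hn_def
  have hv0 : 0 ≤ v ⬝ᵥ v := Finset.sum_nonneg fun i _ => mul_self_nonneg _
  have hA0 : 0 ≤ (A *ᵥ v) ⬝ᵥ (A *ᵥ v) := Finset.sum_nonneg fun i _ => mul_self_nonneg _
  have hE0 : 0 ≤ (E *ᵥ v) ⬝ᵥ (E *ᵥ v) := Finset.sum_nonneg fun i _ => mul_self_nonneg _
  have hcsAE : ((A *ᵥ v) ⬝ᵥ (E *ᵥ v)) ^ 2 ≤ ((A *ᵥ v) ⬝ᵥ (A *ᵥ v)) * ((E *ᵥ v) ⬝ᵥ (E *ᵥ v)) := by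
    simpa only [dotProduct, sq] using Finset.sum_mul_sq_le_sq_mul_sq Finset.univ (A *ᵥ v) (E *ᵥ v)
  have hn : n ^ 2 = v ⬝ᵥ v := Real.sq_sqrt hv0
  have ha : a ^ 2 = (A *ᵥ v) ⬝ᵥ (A *ᵥ v) := Real.sq_sqrt hA0
  have hb : b ^ 2 = (E *ᵥ v) ⬝ᵥ (E *ᵥ v) := Real.sq_sqrt hE0
  have hln : l * n ≤ a := by
    have h1 : Real.sqrt (l ^ 2 * (v ⬝ᵥ v)) ≤ a := Real.sqrt_le_sqrt (hA v)
    rwa [Real.sqrt_mul' _ hv0, Real.sqrt_sq hl] at h1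
  have hmn : b ≤ m * n := by
    have h1 : b ≤ Real.sqrt (m ^ 2 * (v ⬝ᵥ v)) := Real.sqrt_le_sqrt (hE v)
    rwa [Real.sqrt_mul' _ hv0, Real.sqrt_sq hm] at h1
  have hexp : ((A + E) *ᵥ v) ⬝ᵥ ((A + E) *ᵥ v) =
      (A *ᵥ v) ⬝ᵥ (A *ᵥ v) + 2 * ((A *ᵥ v) ⬝ᵥ (E *ᵥ v)) + (E *ᵥ v) ⬝ᵥ (E *ᵥ v) := by
    rw [Matrix.add_mulVec]
    simp only [add_dotProduct, dotProduct_add]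
    rw [dotProduct_comm (E *ᵥ v) (A *ᵥ v)]
    ring
  have hcs : |(A *ᵥ v) ⬝ᵥ (E *ᵥ v)| ≤ a * b := by
    calc |(A *ᵥ v) ⬝ᵥ (E *ᵥ v)| = Real.sqrt (((A *ᵥ v) ⬝ᵥ (E *ᵥ v)) ^ 2) := (Real.sqrt_sq_eq_abs _).symm
      _ ≤ Real.sqrt (((A *ᵥ v) ⬝ᵥ (A *ᵥ v)) * ((E *ᵥ v) ⬝ᵥ (E *ᵥ v))) :=
          Real.sqrt_le_sqrt hcsAE
      _ = a * b := Real.sqrt_mul hA0 _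
  have hcross : -(a * b) ≤ (A *ᵥ v) ⬝ᵥ (E *ᵥ v) := (abs_le.1 hcs).1
  have hnn : 0 ≤ n := Real.sqrt_nonneg _
  have hab : (l - m) * n ≤ a - b := by nlinarith
  have hlmn : 0 ≤ (l - m) * n := mul_nonneg (sub_nonneg.2 hlm) hnn
  have h3 : ((l - m) * n) ^ 2 ≤ (a - b) ^ 2 := pow_le_pow_left₀ hlmn hab 2
  rw [hexp]
  calc (l - m) ^ 2 * (v ⬝ᵥ v) = ((l - m) * n) ^ 2 := by rw [mul_pow, hn]
    _ ≤ (a - b) ^ 2 := h3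
    _ = a ^ 2 - 2 * (a * b) + b ^ 2 := by ring
    _ ≤ (A *ᵥ v) ⬝ᵥ (A *ᵥ v) + 2 * ((A *ᵥ v) ⬝ᵥ (E *ᵥ v)) + (E *ᵥ v) ⬝ᵥ (E *ᵥ v) := by
        rw [ha, hb]; linarith

omit [DecidableEq ι] in
/-- **Schur test** (square real matrices): row sums `Σ_j |E_ij| ≤ r` and column sums `Σ_i |E_ij| ≤ r` give `‖Ev‖² ≤ r²‖v‖²`. -/
theorem mulVec_dotProduct_self_le_of_row_col (E : Matrix ι ι ℝ) {r : ℝ} (hr : 0 ≤ r)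
    (hrow : ∀ i, ∑ j, |E i j| ≤ r) (hcol : ∀ j, ∑ i, |E i j| ≤ r) (v : ι → ℝ) :
    (E *ᵥ v) ⬝ᵥ (E *ᵥ v) ≤ r ^ 2 * (v ⬝ᵥ v) := by
  have hpt : ∀ i, (E *ᵥ v) i * (E *ᵥ v) i ≤ r * ∑ j, |E i j| * v j ^ 2 := by
    intro i
    have h1 : |(E *ᵥ v) i| ≤ ∑ j, |E i j| * |v j| := by
      rw [Matrix.mulVec, dotProduct]
      calc |∑ j, E i j * v j| ≤ ∑ j, |E i j * v j| := Finset.abs_sum_le_sum_abs _ _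
        _ = ∑ j, |E i j| * |v j| := by simp_rw [abs_mul]
    have h2 : (∑ j, |E i j| * |v j|) ^ 2 ≤ (∑ j, |E i j|) * ∑ j, |E i j| * v j ^ 2 := by
      have h := Finset.sum_mul_sq_le_sq_mul_sq Finset.univ (fun j => Real.sqrt |E i j|)
        (fun j => Real.sqrt |E i j| * |v j|)
      have e1 : ∀ j, Real.sqrt |E i j| * (Real.sqrt |E i j| * |v j|) = |E i j| * |v j| := by
        intro j; rw [← mul_assoc, Real.mul_self_sqrt (abs_nonneg _)]
      have e2 : ∀ j, Real.sqrt |E i j| ^ 2 = |E i j| := fun j => Real.sq_sqrt (abs_nonneg _)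
      have e3 : ∀ j, (Real.sqrt |E i j| * |v j|) ^ 2 = |E i j| * v j ^ 2 := by
        intro j; rw [mul_pow, Real.sq_sqrt (abs_nonneg _), sq_abs]
      simp only [e1, e2, e3] at h
      exact h
    have h3 : ((E *ᵥ v) i) ^ 2 ≤ (∑ j, |E i j| * |v j|) ^ 2 := by
      rw [← sq_abs]; exact pow_le_pow_left₀ (abs_nonneg _) h1 2
    have hS : 0 ≤ ∑ j, |E i j| * v j ^ 2 := Finset.sum_nonneg fun j _ => mul_nonneg (abs_nonneg _) (sq_nonneg _)
    calc (E *ᵥ v) i * (E *ᵥ v) i = ((E *ᵥ v) i) ^ 2 := (sq _).symm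
      _ ≤ (∑ j, |E i j| * |v j|) ^ 2 := h3
      _ ≤ (∑ j, |E i j|) * ∑ j, |E i j| * v j ^ 2 := h2
      _ ≤ r * ∑ j, |E i j| * v j ^ 2 := mul_le_mul_of_nonneg_right (hrow i) hS
  have hcolsum : ∀ j, (∑ i, |E i j|) * v j ^ 2 ≤ r * v j ^ 2 := fun j =>
    mul_le_mul_of_nonneg_right (hcol j) (sq_nonneg _)
  calc (E *ᵥ v) ⬝ᵥ (E *ᵥ v) = ∑ i, (E *ᵥ v) i * (E *ᵥ v) i := rfl
    _ ≤ ∑ i, r * ∑ j, |E i j| * v j ^ 2 := Finset.sum_le_sum fun i _ => hpt i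
    _ = r * ∑ j, (∑ i, |E i j|) * v j ^ 2 := by
        rw [← Finset.mul_sum, Finset.sum_comm]
        congr 1
        exact Finset.sum_congr rfl fun j _ => by rw [Finset.sum_mul]
    _ ≤ r * ∑ j, r * v j ^ 2 := mul_le_mul_of_nonneg_left (Finset.sum_le_sum fun j _ => hcolsum j) hr
    _ = r ^ 2 * (v ⬝ᵥ v) := by
        rw [← Finset.mul_sum, dotProduct, ← mul_assoc, sq]
        congr 1
        exact Finset.sum_congr rfl fun j _ => sq (v j)

/-! ### Colour blocks: `blockDiagonal (fun _ => L) = L ⊗ₖ 1` -/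

variable {o : Type*} [Fintype o] [DecidableEq o]

omit [DecidableEq ι] in
/-- The colour-diagonal operator acts colour by colour: `((L ⊗ 1) w)(x, c) = (L w(·, c))(x)`. -/
theorem blockDiagonal_const_mulVec (L : Matrix ι ι ℝ) (w : ι × o → ℝ) (x : ι × o) :
    (blockDiagonal (fun _ : o => L) *ᵥ w) x = (L *ᵥ fun y => w (y, x.2)) x.1 := by
  rw [Matrix.mulVec, dotProduct, Fintype.sum_prod_type, Matrix.mulVec, dotProduct]
  refine Finset.sum_congr rfl fun y _ => ?_
  simp only [Matrix.blockDiagonal_apply, ite_mul, zero_mul]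
  rw [Finset.sum_ite_eq Finset.univ x.2 (fun c => L x.1 y * w (y, c))]
  simp

omit [DecidableEq ι] [DecidableEq o] in
/-- `‖w‖²` on `ι × o` is the sum of the colour components' `‖w(·,c)‖²`. -/
theorem dotProduct_prod_eq_sum (w w' : ι × o → ℝ) :
    w ⬝ᵥ w' = ∑ c : o, (fun y => w (y, c)) ⬝ᵥ (fun y => w' (y, c)) := by
  rw [dotProduct, Fintype.sum_prod_type_right]
  rfl

omit [DecidableEq ι] in
/-- **Form floor for the colour-diagonal operator**: `c‖v‖² ≤ vᵀLv` for all `v` gives `c‖w‖² ≤ wᵀ(L ⊗ 1)w` for all `w`. -/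
theorem floor_blockDiagonal_const (L : Matrix ι ι ℝ) {c : ℝ}
    (h : ∀ v : ι → ℝ, c * (v ⬝ᵥ v) ≤ v ⬝ᵥ (L *ᵥ v)) (w : ι × o → ℝ) :
    c * (w ⬝ᵥ w) ≤ w ⬝ᵥ (blockDiagonal (fun _ : o => L) *ᵥ w) := by
  rw [dotProduct_prod_eq_sum w, dotProduct_prod_eq_sum w, Finset.mul_sum]
  refine Finset.sum_le_sum fun k _ => ?_
  have hk : (fun y => (blockDiagonal (fun _ : o => L) *ᵥ w) (y, k)) = L *ᵥ fun y => w (y, k) := by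
    funext y; rw [blockDiagonal_const_mulVec]
  rw [hk]
  exact h _

omit [DecidableEq ι] in
/-- **Operator floor for the colour-diagonal operator**: `c‖v‖² ≤ ‖Lv‖²` for all `v` gives `c‖w‖² ≤ ‖(L ⊗ 1)w‖²` for all `w`. -/
theorem opFloor_blockDiagonal_const (L : Matrix ι ι ℝ) {c : ℝ}
    (h : ∀ v : ι → ℝ, c * (v ⬝ᵥ v) ≤ (L *ᵥ v) ⬝ᵥ (L *ᵥ v)) (w : ι × o → ℝ) :
    c * (w ⬝ᵥ w) ≤ (blockDiagonal (fun _ : o => L) *ᵥ w) ⬝ᵥ (blockDiagonal (fun _ : o => L) *ᵥ w) := by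
  rw [dotProduct_prod_eq_sum w, dotProduct_prod_eq_sum (blockDiagonal (fun _ : o => L) *ᵥ w), Finset.mul_sum]
  refine Finset.sum_le_sum fun k _ => ?_
  have hk : (fun y => (blockDiagonal (fun _ : o => L) *ᵥ w) (y, k)) = L *ᵥ fun y => w (y, k) := by
    funext y; rw [blockDiagonal_const_mulVec]
  rw [hk]
  exact h _

omit [DecidableEq ι] in
/-- The same operator floor for the Kronecker form `L ⊗ₖ 1` (Mathlib `kronecker_one`). -/
theorem opFloor_kronecker_one (L : Matrix ι ι ℝ) {c : ℝ}
    (h : ∀ v : ι → ℝ, c * (v ⬝ᵥ v) ≤ (L *ᵥ v) ⬝ᵥ (L *ᵥ v)) (w : ι × o → ℝ) :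
    c * (w ⬝ᵥ w) ≤ ((L ⊗ₖ (1 : Matrix o o ℝ)) *ᵥ w) ⬝ᵥ ((L ⊗ₖ (1 : Matrix o o ℝ)) *ᵥ w) := by
  rw [Matrix.kronecker_one]
  exact opFloor_blockDiagonal_const L h w

omit [DecidableEq ι] in
/-- The form floor for the Kronecker form `L ⊗ₖ 1`. -/
theorem floor_kronecker_one (L : Matrix ι ι ℝ) {c : ℝ}
    (h : ∀ v : ι → ℝ, c * (v ⬝ᵥ v) ≤ v ⬝ᵥ (L *ᵥ v)) (w : ι × o → ℝ) :
    c * (w ⬝ᵥ w) ≤ w ⬝ᵥ ((L ⊗ₖ (1 : Matrix o o ℝ)) *ᵥ w) := by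
  rw [Matrix.kronecker_one]
  exact floor_blockDiagonal_const L h w

end Tools


end SpectralFloor

end Summit.QuantumFields.YangMills.Theorems.AllWindowsColdBoxBoxHighLine
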